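import Summits.QuantumFields.YangMills.Theorems.SteinGapBootstrapFreeProbeLawGAssemblyCore
import HarnessLib

/-!
# Crux U `FreeProbeLawG` (stmt-QuantumFields-23756), line `birth` — assembly part A3c: the Stein pair of the block plaquette field

Lead `ym-line-sgb-k1-g1`; helper toward the registered stub `stub_assembly`. From the resummed Schwinger–Dyson identity
(`AssemblyCore.resummed_sd`) applied to the two weight test functions `gZ_a = z_a·W`, `gX_a = x_a·W` (their calculus enters only through
abstract evaluation/derivative hypotheses, supplied by `TestFun.*`), and from the exact/near-projection properties of the truncated
Green `1`-form (`(dω)(p) = s`, `‖dω‖² = s + Δ`, stub `stub_blockGreen`), the pair `X_a = Y_p^a − ⟨dω, Y^a⟩`, `Z_a = ⟨dω, Y^a⟩` satisfies the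
two STEIN-PAIR inequalities consumed by `SteinPair.integral_abs_le`:
`|E[Z_a·Z_a w] − s E[w − δ Z_a² w]| ≤ η`, `|E[Z_a·X_a w] + s δ E[X_a Z_a w]| ≤ η`, `η = ‖ω‖₁ εsd (A₀ + A₁) + 3|Δ|`
(`steinPair_core`). HONEST LABEL: RECORD rung R2ξ-G only; nothing here bears on the Yang–Mills mass gap.
References: E. Meckes, IMS Coll. 5 (2009), Lemma 1 [Meckes2009]; S. Chatterjee, arXiv:1602.01222, §11 [arXiv160201222].
-/

set_option autoImplicit false

noncomputable section

open MeasureTheory Finset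
open Literature.Probability.LatticeModels Literature.MathematicalPhysics.QuantumLattice
open Literature.MathematicalPhysics.QuantumFieldTheory hiding ZdEdge IsLocalObservable IsInfiniteVolumeLimit
open Summit.QuantumFields.YangMills.Theorems.EquipartitionPinsProbe

namespace Summit.QuantumFields.YangMills.Cruxes.FreeProbeLawG.SteinFree

namespace AssemblyPair

/-! ### Elementary pointwise bounds for the Gaussian weight -/

variable {Ω : Type*} {D : ℕ} {X Z : Fin D → Ω → ℝ} {δ : ℝ} {w : Ω → ℝ}

/-- `0 < w ≤ 1`. -/
theorem weight_pos_le_one (hδ : 0 ≤ δ) (hw : ∀ ω, w ω = Real.exp (-(δ / 2) * ∑ b, ((X b ω) ^ 2 + (Z b ω) ^ 2))) (ω : Ω) :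
    0 < w ω ∧ w ω ≤ 1 := by
  rw [hw]
  refine ⟨Real.exp_pos _, ?_⟩
  rw [← Real.exp_zero]
  refine Real.exp_le_exp.2 ?_
  have : 0 ≤ ∑ b, ((X b ω) ^ 2 + (Z b ω) ^ 2) := Finset.sum_nonneg fun b _ => by positivity
  nlinarith

/-- `δ Z_a² w ≤ 1`. -/
theorem delta_sq_weight_le_one (hδ : 0 ≤ δ) (hw : ∀ ω, w ω = Real.exp (-(δ / 2) * ∑ b, ((X b ω) ^ 2 + (Z b ω) ^ 2)))
    (a : Fin D) (ω : Ω) : δ * (Z a ω) ^ 2 * w ω ≤ 1 ∧ δ * (X a ω) ^ 2 * w ω ≤ 1 := by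
  set Sg : ℝ := ∑ b, ((X b ω) ^ 2 + (Z b ω) ^ 2) with hSg
  have hS0 : 0 ≤ Sg := Finset.sum_nonneg fun b _ => by positivity
  have hle : (X a ω) ^ 2 + (Z a ω) ^ 2 ≤ Sg :=
    Finset.single_le_sum (f := fun b => (X b ω) ^ 2 + (Z b ω) ^ 2) (fun b _ => by positivity) (Finset.mem_univ a)
  have hw' : w ω = Real.exp (-(δ / 2 * Sg)) := by
    rw [hw ω, ← hSg]; ring_nf
  -- `δ u w ≤ δ Sg e^{-δ Sg/2} = 2 (t e^{-t}) ≤ 2`? we need `≤ 1`: use `u ≤ Sg/1` only gives `2/e`; sharpen with `u ≤ Sg`: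
  -- `δ u e^{-δ Sg /2} ≤ δ Sg e^{-δ Sg/2} = 2 · (t e^{-t})`, `t = δ Sg/2`, and `2 t e^{-t} ≤ 2/e ≤ 1`.
  have key : δ * Sg * Real.exp (-(δ / 2 * Sg)) ≤ 1 := by
    have ht : 0 ≤ δ / 2 * Sg := by positivity
    have h1 : δ / 2 * Sg ≤ Real.exp (δ / 2 * Sg - 1) := by have := Real.add_one_le_exp (δ / 2 * Sg - 1); linarith
    have h2 : Real.exp (δ / 2 * Sg - 1) * Real.exp (-(δ / 2 * Sg)) = Real.exp (-1) := by rw [← Real.exp_add]; ring_nf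
    have h3 : 2 * Real.exp (-1) ≤ 1 := by
      have := Real.exp_one_gt_d9
      have hpos := Real.exp_pos (1 : ℝ)
      rw [Real.exp_neg]
      rw [show 2 * (Real.exp 1)⁻¹ = 2 / Real.exp 1 by ring, div_le_one hpos]
      linarith
    calc δ * Sg * Real.exp (-(δ / 2 * Sg)) = 2 * ((δ / 2 * Sg) * Real.exp (-(δ / 2 * Sg))) := by ring
      _ ≤ 2 * (Real.exp (δ / 2 * Sg - 1) * Real.exp (-(δ / 2 * Sg))) :=
          mul_le_mul_of_nonneg_left (mul_le_mul_of_nonneg_right h1 (Real.exp_pos _).le) (by norm_num)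
      _ = 2 * Real.exp (-1) := by rw [h2]
      _ ≤ 1 := h3
  have hwpos : 0 < Real.exp (-(δ / 2 * Sg)) := Real.exp_pos _
  constructor
  · rw [hw']
    calc δ * (Z a ω) ^ 2 * Real.exp (-(δ / 2 * Sg)) ≤ δ * Sg * Real.exp (-(δ / 2 * Sg)) := by
          refine mul_le_mul_of_nonneg_right (mul_le_mul_of_nonneg_left ?_ hδ) hwpos.le
          nlinarith [sq_nonneg (X a ω)]
      _ ≤ 1 := key
  · rw [hw']
    calc δ * (X a ω) ^ 2 * Real.exp (-(δ / 2 * Sg)) ≤ δ * Sg * Real.exp (-(δ / 2 * Sg)) := by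
          refine mul_le_mul_of_nonneg_right (mul_le_mul_of_nonneg_left ?_ hδ) hwpos.le
          nlinarith [sq_nonneg (Z a ω)]
      _ ≤ 1 := key

/-- `δ |X_a Z_a| w ≤ 1`. -/
theorem delta_abs_mul_weight_le_one (hδ : 0 ≤ δ) (hw : ∀ ω, w ω = Real.exp (-(δ / 2) * ∑ b, ((X b ω) ^ 2 + (Z b ω) ^ 2)))
    (a : Fin D) (ω : Ω) : |δ * X a ω * Z a ω * w ω| ≤ 1 := by
  obtain ⟨h1, h2⟩ := delta_sq_weight_le_one hδ hw a ω
  obtain ⟨hw0, _⟩ := weight_pos_le_one hδ hw ω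
  rw [abs_mul, abs_mul, abs_mul, abs_of_nonneg hδ, abs_of_pos hw0]
  -- `2|x z| ≤ x² + z²`
  have h := two_mul_le_add_sq (|X a ω|) (|Z a ω|)
  rw [sq_abs, sq_abs] at h
  have hδw : 0 ≤ δ * w ω := mul_nonneg hδ hw0.le
  calc δ * |X a ω| * |Z a ω| * w ω = (δ * w ω) * (2 * |X a ω| * |Z a ω|) / 2 := by ring
    _ ≤ (δ * w ω) * ((X a ω) ^ 2 + (Z a ω) ^ 2) / 2 := by
        have := mul_le_mul_of_nonneg_left h hδw
        linarith
    _ = (δ * (X a ω) ^ 2 * w ω + δ * (Z a ω) ^ 2 * w ω) / 2 := by ring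
    _ ≤ 1 := by linarith

/-! ### The Stein pair -/

variable {G : Type} [Group G] [TopologicalSpace G] [IsTopologicalGroup G] [CompactSpace G]
  [MeasurableSpace G] [BorelSpace G] [SecondCountableTopology G]

/-- **The Stein pair of the block plaquette field.** See the module docstring. The calculus of the two weight test functions enters
only through the evaluation (`hZval`, `hXval`) and directional-derivative (`hZder`, `hXder`) hypotheses. -/
theorem steinPair_core (r : LatticeRep G) (β : ℝ) (μ : Measure (LGConfig 4 G)) [IsProbabilityMeasure μ]
    (S : Finset (ZdPlaquette 4)) (E : Finset (ZdEdge 4)) (ω : ZdEdge 4 → ℝ) (hωE : ∀ e, ω e ≠ 0 → e ∈ E)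
    {εsd : ℝ} (hε : 0 ≤ εsd)
    (hSD : ∀ (a : Fin (lieDim r)), ∀ e ∈ E, ∀ (g : (↥S → Fin (lieDim r) → ℝ) → ℝ) (M : ℝ), 0 ≤ M → ContDiff ℝ 1 g →
      (∀ y, |g y| ≤ 1) → (∀ y, ‖fderiv ℝ g y‖ ≤ M) →
      |(∑ p' : ↥S, plaquetteCurl (fun e' => if e' = e then (1 : ℝ) else 0) (p' : ZdPlaquette 4) *
            ∫ U, fderiv ℝ g (fun q b => plaqField r β U (q : ZdPlaquette 4) b)
              (fun q b => if q = p' ∧ b = a then (1 : ℝ) else 0) ∂μ) -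
          ∫ U, g (fun q b => plaqField r β U (q : ZdPlaquette 4) b) *
            (∑ p' ∈ S, plaquetteCurl (fun e' => if e' = e then (1 : ℝ) else 0) p' * plaqField r β U p' a) ∂μ| ≤
        εsd * (1 + M))
    {W : ℝ} (hW : ∑ e ∈ E, |ω e| ≤ W)
    (X Z : Fin (lieDim r) → LGConfig 4 G → ℝ) (hXc : ∀ a, Continuous (X a)) (hZc : ∀ a, Continuous (Z a))
    (hZdef : ∀ a U, Z a U = ∑ p' ∈ S, plaquetteCurl ω p' * plaqField r β U p' a)
    {s Δ δ : ℝ} (hδ : 0 < δ) (w : LGConfig 4 G → ℝ)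
    (hw : ∀ U, w U = Real.exp (-(δ / 2) * ∑ b, ((X b U) ^ 2 + (Z b U) ^ 2)))
    (gZ gX : Fin (lieDim r) → ((↥S → Fin (lieDim r) → ℝ) → ℝ)) {A₀ A₁ : ℝ} (hA₀ : 0 < A₀) (hA₁ : 0 ≤ A₁)
    (hZcd : ∀ a, ContDiff ℝ 1 (gZ a)) (hZ0 : ∀ a y, |gZ a y| ≤ A₀) (hZ1 : ∀ a y, ‖fderiv ℝ (gZ a) y‖ ≤ A₁)
    (hZval : ∀ a U, gZ a (fun (q : ↥S) (b : Fin (lieDim r)) => plaqField r β U (q : ZdPlaquette 4) b) = Z a U * w U)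
    (hZder : ∀ a U, fderiv ℝ (gZ a) (fun (q : ↥S) (b : Fin (lieDim r)) => plaqField r β U (q : ZdPlaquette 4) b)
        (fun q b => if b = a then plaquetteCurl ω (q : ZdPlaquette 4) else 0) =
      (s + Δ) * (w U - δ * (Z a U) ^ 2 * w U) + (-Δ) * (-δ * X a U * Z a U * w U))
    (hXcd : ∀ a, ContDiff ℝ 1 (gX a)) (hX0 : ∀ a y, |gX a y| ≤ A₀) (hX1 : ∀ a y, ‖fderiv ℝ (gX a) y‖ ≤ A₁)
    (hXval : ∀ a U, gX a (fun (q : ↥S) (b : Fin (lieDim r)) => plaqField r β U (q : ZdPlaquette 4) b) = X a U * w U)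
    (hXder : ∀ a U, fderiv ℝ (gX a) (fun (q : ↥S) (b : Fin (lieDim r)) => plaqField r β U (q : ZdPlaquette 4) b)
        (fun q b => if b = a then plaquetteCurl ω (q : ZdPlaquette 4) else 0) =
      (s + Δ) * (-δ * X a U * Z a U * w U) + (-Δ) * (w U - δ * (X a U) ^ 2 * w U)) :
    ∀ a : Fin (lieDim r),
      |(∫ U, Z a U * (Z a U * w U) ∂μ) - s * ∫ U, (w U - δ * (Z a U) ^ 2 * w U) ∂μ| ≤
          W * (εsd * (A₀ + A₁)) + 3 * |Δ| ∧
      |(∫ U, Z a U * (X a U * w U) ∂μ) + s * δ * ∫ U, X a U * Z a U * w U ∂μ| ≤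
          W * (εsd * (A₀ + A₁)) + 3 * |Δ| := by
  intro a
  have hint : ∀ {f : LGConfig 4 G → ℝ}, Continuous f → Integrable f μ := fun hf =>
    AssemblyCore.integrable_of_continuous_bdd μ hf
  have hwc : Continuous w := by
    rw [show w = fun U => Real.exp (-(δ / 2) * ∑ b, ((X b U) ^ 2 + (Z b U) ^ 2)) from funext hw]
    exact Real.continuous_exp.comp (continuous_const.mul
      (continuous_finsetSum _ fun b _ => ((hXc b).pow 2).add ((hZc b).pow 2)))
  -- the two resummed identities
  have hRZ := AssemblyCore.resummed_sd r β μ S E ω hωE a (hSD a) (gZ a) hA₀ hA₁ (hZcd a) (hZ0 a) (hZ1 a)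
  have hRX := AssemblyCore.resummed_sd r β μ S E ω hωE a (hSD a) (gX a) hA₀ hA₁ (hXcd a) (hX0 a) (hX1 a)
  simp only [hZder, hZval] at hRZ
  simp only [hXder, hXval] at hRX
  simp only [← hZdef] at hRZ hRX
  -- common bound `W εsd (A₀ + A₁)`
  have hWb : (∑ e ∈ E, |ω e|) * (εsd * (A₀ + A₁)) ≤ W * (εsd * (A₀ + A₁)) :=
    mul_le_mul_of_nonneg_right hW (by positivity)
  -- pointwise bounds and integrals of the auxiliary terms
  have hb1 : ∀ U, |w U - δ * (Z a U) ^ 2 * w U| ≤ 2 := fun U => by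
    obtain ⟨hw0, hw1⟩ := weight_pos_le_one hδ.le hw U
    obtain ⟨hz, -⟩ := delta_sq_weight_le_one hδ.le hw a U
    have hz0 : 0 ≤ δ * (Z a U) ^ 2 * w U := by positivity
    rw [abs_le]; constructor <;> linarith
  have hb1' : ∀ U, |w U - δ * (X a U) ^ 2 * w U| ≤ 2 := fun U => by
    obtain ⟨hw0, hw1⟩ := weight_pos_le_one hδ.le hw U
    obtain ⟨-, hx⟩ := delta_sq_weight_le_one hδ.le hw a U
    have hx0 : 0 ≤ δ * (X a U) ^ 2 * w U := by positivity
    rw [abs_le]; constructor <;> linarith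
  have hb2 : ∀ U, |δ * X a U * Z a U * w U| ≤ 1 := fun U => delta_abs_mul_weight_le_one hδ.le hw a U
  have cA : Continuous fun U => w U - δ * (Z a U) ^ 2 * w U := hwc.sub ((continuous_const.mul ((hZc a).pow 2)).mul hwc)
  have cA' : Continuous fun U => w U - δ * (X a U) ^ 2 * w U := hwc.sub ((continuous_const.mul ((hXc a).pow 2)).mul hwc)
  have cB : Continuous fun U => X a U * Z a U * w U := ((hXc a).mul (hZc a)).mul hwc
  have hIA : |∫ U, (w U - δ * (Z a U) ^ 2 * w U) ∂μ| ≤ 2 := by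
    refine (abs_integral_le_integral_abs).trans ?_
    calc ∫ U, |w U - δ * (Z a U) ^ 2 * w U| ∂μ ≤ ∫ _U, (2 : ℝ) ∂μ :=
          integral_mono (hint cA).abs (integrable_const _) hb1
      _ = 2 := by simp
  have hIA' : |∫ U, (w U - δ * (X a U) ^ 2 * w U) ∂μ| ≤ 2 := by
    refine (abs_integral_le_integral_abs).trans ?_
    calc ∫ U, |w U - δ * (X a U) ^ 2 * w U| ∂μ ≤ ∫ _U, (2 : ℝ) ∂μ :=
          integral_mono (hint cA').abs (integrable_const _) hb1'
      _ = 2 := by simp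
  have hIB : |δ * ∫ U, X a U * Z a U * w U ∂μ| ≤ 1 := by
    rw [← integral_const_mul]
    refine (abs_integral_le_integral_abs).trans ?_
    calc ∫ U, |δ * (X a U * Z a U * w U)| ∂μ ≤ ∫ _U, (1 : ℝ) ∂μ :=
          integral_mono ((hint cB).const_mul δ).abs (integrable_const _) fun U => by
            have := hb2 U; rwa [show δ * X a U * Z a U * w U = δ * (X a U * Z a U * w U) by ring] at this
      _ = 1 := by simp
  -- rewrite the derivative-side integrals
  have iA : Integrable (fun U => w U - δ * (Z a U) ^ 2 * w U) μ := hint cA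
  have iA' : Integrable (fun U => w U - δ * (X a U) ^ 2 * w U) μ := hint cA'
  have iB : Integrable (fun U => -δ * X a U * Z a U * w U) μ := hint (((continuous_const.mul (hXc a)).mul (hZc a)).mul hwc)
  have eZ : ∫ U, ((s + Δ) * (w U - δ * (Z a U) ^ 2 * w U) + (-Δ) * (-δ * X a U * Z a U * w U)) ∂μ =
      (s + Δ) * (∫ U, (w U - δ * (Z a U) ^ 2 * w U) ∂μ) + Δ * (δ * ∫ U, X a U * Z a U * w U ∂μ) := by
    rw [integral_add (iA.const_mul _) (iB.const_mul _), integral_const_mul, integral_const_mul, ← integral_const_mul δ]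
    congr 1
    rw [← neg_mul_neg, neg_neg, ← integral_neg]
    congr 1
    refine integral_congr_ae (ae_of_all _ fun U => ?_)
    ring
  have eX : ∫ U, ((s + Δ) * (-δ * X a U * Z a U * w U) + (-Δ) * (w U - δ * (X a U) ^ 2 * w U)) ∂μ =
      -((s + Δ) * (δ * ∫ U, X a U * Z a U * w U ∂μ)) - Δ * ∫ U, (w U - δ * (X a U) ^ 2 * w U) ∂μ := by
    rw [integral_add (iB.const_mul _) (iA'.const_mul _), integral_const_mul, integral_const_mul, ← integral_const_mul δ]
    have : ∫ U, -δ * X a U * Z a U * w U ∂μ = -∫ U, δ * (X a U * Z a U * w U) ∂μ := by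
      rw [← integral_neg]
      exact integral_congr_ae (ae_of_all _ fun U => by ring)
    rw [this]
    ring
  -- field-side integrands
  have fZ : ∫ U, Z a U * w U * Z a U ∂μ = ∫ U, Z a U * (Z a U * w U) ∂μ :=
    integral_congr_ae (ae_of_all _ fun U => by ring)
  have fX : ∫ U, X a U * w U * Z a U ∂μ = ∫ U, Z a U * (X a U * w U) ∂μ :=
    integral_congr_ae (ae_of_all _ fun U => by ring)
  rw [eZ, fZ] at hRZ
  rw [eX, fX] at hRX
  -- the `Δ`-terms are at most `3|Δ|`
  have hΔ1 : |Δ * (δ * ∫ U, X a U * Z a U * w U ∂μ)| ≤ |Δ| := by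
    rw [abs_mul]; exact (mul_le_mul_of_nonneg_left hIB (abs_nonneg _)).trans (le_of_eq (mul_one _))
  have hΔ2 : |Δ * ∫ U, (w U - δ * (Z a U) ^ 2 * w U) ∂μ| ≤ 2 * |Δ| := by
    rw [abs_mul]; nlinarith [hIA, abs_nonneg Δ]
  have hΔ2' : |Δ * ∫ U, (w U - δ * (X a U) ^ 2 * w U) ∂μ| ≤ 2 * |Δ| := by
    rw [abs_mul]; nlinarith [hIA', abs_nonneg Δ]
  constructor
  · -- `|∫ Z(Zw) − s ∫(w − δZ²w)| ≤ err + |Δ ∫(w−δZ²w)| + |Δ δ ∫ XZw|`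
    have h := hRZ.trans hWb
    have key : (∫ U, Z a U * (Z a U * w U) ∂μ) - s * ∫ U, (w U - δ * (Z a U) ^ 2 * w U) ∂μ =
        -(((s + Δ) * (∫ U, (w U - δ * (Z a U) ^ 2 * w U) ∂μ) + Δ * (δ * ∫ U, X a U * Z a U * w U ∂μ)) -
          ∫ U, Z a U * (Z a U * w U) ∂μ) + Δ * (∫ U, (w U - δ * (Z a U) ^ 2 * w U) ∂μ) +
          Δ * (δ * ∫ U, X a U * Z a U * w U ∂μ) := by ring
    rw [key]
    have t1 : |-(((s + Δ) * (∫ U, (w U - δ * (Z a U) ^ 2 * w U) ∂μ) + Δ * (δ * ∫ U, X a U * Z a U * w U ∂μ)) -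
          ∫ U, Z a U * (Z a U * w U) ∂μ)| ≤ W * (εsd * (A₀ + A₁)) := by rw [abs_neg]; exact h
    have t2 := abs_add_le (-(((s + Δ) * (∫ U, (w U - δ * (Z a U) ^ 2 * w U) ∂μ) + Δ * (δ * ∫ U, X a U * Z a U * w U ∂μ)) -
          ∫ U, Z a U * (Z a U * w U) ∂μ) + Δ * (∫ U, (w U - δ * (Z a U) ^ 2 * w U) ∂μ))
        (Δ * (δ * ∫ U, X a U * Z a U * w U ∂μ))
    have t3 := abs_add_le (-(((s + Δ) * (∫ U, (w U - δ * (Z a U) ^ 2 * w U) ∂μ) + Δ * (δ * ∫ U, X a U * Z a U * w U ∂μ)) -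
          ∫ U, Z a U * (Z a U * w U) ∂μ)) (Δ * (∫ U, (w U - δ * (Z a U) ^ 2 * w U) ∂μ))
    linarith
  · have h := hRX.trans hWb
    have key : (∫ U, Z a U * (X a U * w U) ∂μ) + s * δ * ∫ U, X a U * Z a U * w U ∂μ =
        -((-((s + Δ) * (δ * ∫ U, X a U * Z a U * w U ∂μ)) - Δ * ∫ U, (w U - δ * (X a U) ^ 2 * w U) ∂μ) -
          ∫ U, Z a U * (X a U * w U) ∂μ) + (-(Δ * (δ * ∫ U, X a U * Z a U * w U ∂μ))) +
          (-(Δ * ∫ U, (w U - δ * (X a U) ^ 2 * w U) ∂μ)) := by ring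
    rw [key]
    have t1 : |-((-((s + Δ) * (δ * ∫ U, X a U * Z a U * w U ∂μ)) - Δ * ∫ U, (w U - δ * (X a U) ^ 2 * w U) ∂μ) -
          ∫ U, Z a U * (X a U * w U) ∂μ)| ≤ W * (εsd * (A₀ + A₁)) := by rw [abs_neg]; exact h
    have t2 := abs_add_le (-((-((s + Δ) * (δ * ∫ U, X a U * Z a U * w U ∂μ)) - Δ * ∫ U, (w U - δ * (X a U) ^ 2 * w U) ∂μ) -
          ∫ U, Z a U * (X a U * w U) ∂μ) + (-(Δ * (δ * ∫ U, X a U * Z a U * w U ∂μ))))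
        (-(Δ * ∫ U, (w U - δ * (X a U) ^ 2 * w U) ∂μ))
    have t3 := abs_add_le (-((-((s + Δ) * (δ * ∫ U, X a U * Z a U * w U ∂μ)) - Δ * ∫ U, (w U - δ * (X a U) ^ 2 * w U) ∂μ) -
          ∫ U, Z a U * (X a U * w U) ∂μ)) (-(Δ * (δ * ∫ U, X a U * Z a U * w U ∂μ)))
    have t4 : |-(Δ * (δ * ∫ U, X a U * Z a U * w U ∂μ))| ≤ |Δ| := by rw [abs_neg]; exact hΔ1
    have t5 : |-(Δ * ∫ U, (w U - δ * (X a U) ^ 2 * w U) ∂μ)| ≤ 2 * |Δ| := by rw [abs_neg]; exact hΔ2'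
    linarith

end AssemblyPair

end Summit.QuantumFields.YangMills.Cruxes.FreeProbeLawG.SteinFree

end
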